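import Summits.ResolutionOfSingularities.ResolutionOfSingularities.Theorems.RisoStrataRisoCentresResolveReduction
import Summits.ResolutionOfSingularities.ResolutionOfSingularities.Theorems.RisoStrataRisoCentresResolveCurveStep
import Summits.ResolutionOfSingularities.ResolutionOfSingularities.Theorems.RisoStrataRisoCentresResolveCurveReach
import Summits.ResolutionOfSingularities.ResolutionOfSingularities.Theorems.RisoStrataRisoCentresResolveCurveAssembly

/-!
# Route RisoStrata — support item `RisoCurves` (stmt-ResolutionOfSingularities-18550): the curve case
# of the riso schedule, PROVED

`RisoCurves` is the transcendence-degree-one case of the crux `RisoCentresResolve` (Monreal,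
arXiv:2606.12554, Question 1.6 in characteristic `p`): for a projective presentation
`K = k(hᵢ/hⱼ)` of a function field of a CURVE over an algebraically closed field there is ONE
finite schedule of riso-cut blow-ups which, along every valuation ring `O ⊇ k` of `K`, every chart
and every admissible chart path, ends with a regular local ring at the centre of `O` — resolution
of curve singularities by blowing up the (reduced) singular points, in riso dress (Kollár 2007,
Ch. 1). Proof: the hypothesis `∃ t` transcendental with `K/k(t)` algebraic gives
`Algebra.trdeg k K ≤ 1`; riso local uniformization for curves along the top word (the landed curve
stubs of line `Sketch` of the crux: `stub_rcrCurveAssembly`, `stub_rcrCurveStep`,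
`stub_rcrCurveReach` — quadratic transforms along `O`, E. Noether finiteness, Krull–Akizuki,
Herrmann–Ikeda–Orbanz (30.2)); then the landed Zariski–Riemann transfer of the crux
(`stub_rcrTransfer` with persistence `stub_rcrPersist`, path independence `stub_rcrPathIndep` +
`stub_rcrRefine` + `RtdLocal_of`, neighbourhoods `stub_rcrRegNbhd`) turns the uniformizing word
into one finite schedule, exactly as in `risoCentresResolve_of_localUnif`.
-/

noncomputable section

set_option linter.dupNamespace false -- mandated namespace of this single-conjunct summit

namespace Summit.ResolutionOfSingularities.ResolutionOfSingularities.Theorems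

open Summit.ResolutionOfSingularities.ResolutionOfSingularities.Theses.RisoStrata
open Literature.AlgebraicGeometry.Resolution
open scoped IntermediateField.algebraAdjoinAdjoin

/-- A field extension `K/k` algebraic over `k(t)` for a single element `t` has transcendence
degree `≤ 1`. [folklore] -/
theorem trdeg_le_one_of_isAlgebraic_adjoin_singleton {k K : Type} [Field k] [Field K]
    [Algebra k K] (t : K)
    (halg : Algebra.IsAlgebraic ↥(IntermediateField.adjoin k ({t} : Set K)) K) :
    Algebra.trdeg k K ≤ 1 := by
  haveI := halg
  haveI : Algebra.IsAlgebraic ↥(Algebra.adjoin k ({t} : Set K)) K :=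
    Algebra.IsAlgebraic.trans (R := ↥(Algebra.adjoin k ({t} : Set K)))
      (S := ↥(IntermediateField.adjoin k ({t} : Set K))) (A := K)
  calc Algebra.trdeg k K ≤ Cardinal.mk ({t} : Set K) :=
        Algebra.IsAlgebraic.trdeg_le_cardinalMk k ({t} : Set K)
    _ = 1 := Cardinal.mk_singleton t

/-- **`RisoCurves` (stmt-ResolutionOfSingularities-18550): the riso schedule resolves curves.**
For a prime `p`, an algebraically closed field `k` of characteristic `p` and a projective
presentation `K = k(hᵢ/hⱼ)` of a field of transcendence degree one (`K` algebraic over `k(t)` for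
a transcendental `t`), one finite schedule of riso-cut blow-ups (a prefix of the constant top word)
ends, along every valuation ring `O ⊇ k`, every chart `k[hᵢ/hⱼ] ⊆ O` and every admissible chart
path, with a regular local ring at the centre of `O`. [cite: Kollar2007, Ch. 1] -/
theorem risoCurves_proof : RisoCurves := by
  intro p hp k _ _ _ K _ _ N h hh htr hgen
  have htr1 : Algebra.trdeg k K ≤ 1 := by
    obtain ⟨t, -, halg⟩ := htr
    exact trdeg_le_one_of_isAlgebraic_adjoin_singleton t halg
  show RisoSchedule (fun (B : Subalgebra k K) (m : Ideal ↥B) (d : ℕ) => ¬ ∃ (n : ℕ) (g : Fin n → ↥B),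
        (∀ i, g i ∈ m) ∧ Algebra.adjoin k (Set.range fun i => (g i : K)) = B ∧
        ∃ W : Submodule k (Fin n → k), d + 1 ≤ Module.finrank k ↥W ∧
        ∃ φ : {α : ↥B →ₐ[k] HahnSeries ℚ k // ∀ b ∈ m, 0 < (α b).orderTop} → (Fin n → HahnSeries ℚ k),
          (∀ a b : {α : ↥B →ₐ[k] HahnSeries ℚ k // ∀ b ∈ m, 0 < (α b).orderTop}, a ≠ b →
            ∃ j, ∀ i, (a.1 (g j) - b.1 (g j)).orderTop <
              ((φ a i - φ b i) - (a.1 (g i) - b.1 (g i))).orderTop) ∧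
          (∀ a i, 0 < (φ a i).orderTop) ∧
          (∀ a, ∀ w : Fin n → HahnSeries ℚ k, (∀ i, 0 < (w i).orderTop) →
            w ∈ Submodule.span (HahnSeries ℚ k)
              ((fun u : Fin n → k => fun i => HahnSeries.C (u i)) '' (W : Set (Fin n → k))) →
              ∃ b, φ b = φ a + w)) N h
  obtain ⟨w, hw⟩ := stub_rcrCurveAssembly stub_rcrCurveStep stub_rcrCurveReach p hp k K N h hh hgen htr1
  have hLoc := reduction_risoLocal_cut p hp k K
  obtain ⟨T, hT⟩ := stub_rcrTransfer _ N h hh w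
    (fun O B hB hBO d xt hV hreg => stub_rcrPersist _ O B hB hBO d xt hV hreg)
    (fun O B B' hB hB' hBO hB'O hloc d xt xt' hV hV' =>
      stub_rcrPathIndep _ hLoc O B B' hB hB' hBO hB'O hloc
        (stub_rcrRefine O B B' hB hB' hBO hB'O hloc) d xt xt' hV hV')
    (fun O B hB hBO hreg => stub_rcrRegNbhd O B hB hBO hreg) hw
  refine ⟨(List.range T).map w, fun O hk j hj x hadm => ?_⟩
  have hlen : ((List.range T).map w).length = T := by simp
  rw [hlen]
  refine hT O hk j hj x fun s hs => ?_
  have := hadm s (by rw [hlen]; exact hs)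
  rwa [reduction_getD_map_range w hs] at this

end Summit.ResolutionOfSingularities.ResolutionOfSingularities.Theorems

end
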